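import Mathlib
import Summits.Ventures.HodgeRepro.Tier4.Common.CompactUnimodular

/-!
# Tier4/Common/KTypeProjector — the `(C, χ)`-projector `e_{C,χ}` by a compact subgroup with a Haar probability
measure: definition, equivariance, idempotence, linearity, continuity, and THE PROJECTOR IDENTITY
`R(f) ψ = R(f)(e_{C,χ} ψ)` for a right-`(C, χ̄)`-equivariant test function `f`

Blind re-derivation cell `pub-hodge-repro`, Tier 4 «prove the step» (README §9–§10), seat t4-typer-2 (gen 3).
Target tree path `lean/Summits/Ventures/HodgeRepro/Tier4/Common/KTypeProjector.lean`.  Mathlib +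
`Common.CompactUnimodular`; no literature.  Generic over a topological group `G`: `GA W` (AdelicDefs) and L1's
`RTF.Setting G` consume by name — `rightRegular W μ f ψ x`, `RTF.Setting.R S f ψ x` are DEFINITIONALLY the displayed
integral `∫ y, f y * ψ (x * y) ∂μ` of the statements below.

WHY (L4-p1 KTypeTransport: «what is NOT here: `hvan` … needs the projector identity, i.e. harmonic analysis on the
compact tori»; L4-p2 S13576 / S13737: «the `(τ,K)`-projector … by a compact subgroup with a Haar probability
measure: `R f ψ = R f (e ψ)` for right-`(C, χ̄)`-equivariant `f`, self-adjointness on `D_G`, vanishing on the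
orthogonal complement — typer vocabulary the tree lacks»).  This module is the first two thirds of that vocabulary;
the adjoint identity on a fundamental domain and the vanishing on the orthogonal complement are
`Tier4/Common/KTypeProjectorAdjoint.lean`.

* **`kProj C ν χ ψ x := ∫ κ : C, conj (χ κ) * ψ (x * κ) ∂ν`** — `e_{C,χ} ψ`, the average of the right translates of `ψ`
  by the compact subgroup `C` against the conjugate character; for `χ = 1` the `C`-invariant average `e_C ψ`
  (the `e_K` of the finite-part levels);
* `kProj_apply_mul` — `e_{C,χ} ψ (x κ₀) = χ(κ₀) · e_{C,χ} ψ (x)` for `κ₀ ∈ C`: the OUTPUT is right-`(C, χ)`-equivariant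
  (left invariance of `ν` and the character identities only);
* `kProj_of_equivariant` — `e_{C,χ} ψ = ψ` for a right-`(C, χ)`-equivariant `ψ` (`ν` a probability measure);
* `kProj_kProj` — `e_{C,χ}` is idempotent; `kProj_zero`, `kProj_const_mul`, `kProj_add`, `kProj_sub` — linear;
* `continuous_kProj` — `e_{C,χ} ψ` is continuous for continuous `ψ` (parametric integral over the compact `C`);
* **`integral_mul_kProj_eq`** — THE PROJECTOR IDENTITY: for a test function `f` with `f (y κ) = conj χ(κ) · f (y)`
  (`κ ∈ C`) and a continuous `ψ`, `∫ f(y) (e_{C,χ} ψ)(x y) dμ(y) = ∫ f(y) ψ(x y) dμ(y)` — i.e.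
  `R(f)(e_{C,χ} ψ) = R(f) ψ` (Fubini on `μ.prod ν`, right invariance of `μ`, the character identities);
* the character glue `chi_one`, `chi_inv`, `conj_chi_inv`, `conj_eq_inv_of_norm_one`.

Hypotheses are DISPLAYED as Mathlib predicates: `[ν.IsMulLeftInvariant]` / `[IsProbabilityMeasure ν]` on the
measure of `C`, `[CompactSpace C]` (from `IsCompact (C : Set G)` by `compactSpace_subgroup_of_isCompact`),
`[μ.IsMulRightInvariant]` on the group measure (L1's `Setting.rightInv`; on `GA W` L1-p5's
`isMulRightInvariant_of_isFundamentalDomain`), the character identities `χ (a b) = χ a χ b` and `‖χ a‖ = 1` on `C`.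
NOT here: that a given subspace `V` is stable under `e_{C,χ}` (the line's analysis), anything about the joint
two-torus condition of `kTypeSpace` (one `(C, χ)` at a time; projectors of commuting subgroups compose).

Nothing here says anything about the status of the Hodge conjecture for CM abelian varieties, which is NOT proved
(HC_CM is NOT proved by anyone in this repository).
-/

set_option autoImplicit false

noncomputable section

namespace Summit.Ventures.HodgeRepro.Tier4.Common

open MeasureTheory Measure Topology Set
open scoped ComplexConjugate

section Character

/-- `conj z = z⁻¹` on the unit circle. -/
theorem conj_eq_inv_of_norm_one {z : ℂ} (hz : ‖z‖ = 1) : conj z = z⁻¹ := by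
  have h : conj z * z = 1 := by rw [Complex.conj_mul', hz]; norm_num
  exact eq_inv_of_mul_eq_one_left h

variable {G : Type*} [Group G] (C : Subgroup G) {χ : G → ℂ}

/-- A multiplicative unit-modulus function on a subgroup takes the value `1` at `1`. -/
theorem chi_one (hχ : ∀ a ∈ C, ∀ b ∈ C, χ (a * b) = χ a * χ b) (hu : ∀ a ∈ C, ‖χ a‖ = 1) : χ 1 = 1 := by
  have h0 : χ 1 ≠ 0 := by
    intro h
    have := hu 1 C.one_mem
    rw [h, norm_zero] at this
    exact zero_ne_one this
  have h := hχ 1 C.one_mem 1 C.one_mem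
  rw [one_mul] at h
  exact (mul_left_cancel₀ h0 (h.symm.trans (mul_one _).symm))

/-- `χ (a⁻¹) = (χ a)⁻¹` on the subgroup. -/
theorem chi_inv (hχ : ∀ a ∈ C, ∀ b ∈ C, χ (a * b) = χ a * χ b) (hu : ∀ a ∈ C, ‖χ a‖ = 1) {a : G} (ha : a ∈ C) :
    χ a⁻¹ = (χ a)⁻¹ := by
  apply eq_inv_of_mul_eq_one_left
  rw [← hχ a⁻¹ (C.inv_mem ha) a ha, inv_mul_cancel]
  exact chi_one C hχ hu

/-- `conj χ(a⁻¹) = χ a` on the subgroup (the identity behind the equivariance of the projector's output). -/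
theorem conj_chi_inv (hχ : ∀ a ∈ C, ∀ b ∈ C, χ (a * b) = χ a * χ b) (hu : ∀ a ∈ C, ‖χ a‖ = 1) {a : G}
    (ha : a ∈ C) : conj (χ a⁻¹) = χ a := by
  rw [chi_inv C hχ hu ha, map_inv₀, conj_eq_inv_of_norm_one (hu a ha), inv_inv]

/-- `conj χ(a) · χ(a) = 1` on the subgroup. -/
theorem conj_chi_mul_chi (hu : ∀ a ∈ C, ‖χ a‖ = 1) {a : G} (ha : a ∈ C) : conj (χ a) * χ a = 1 := by
  rw [Complex.conj_mul', hu a ha]; norm_num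

end Character

section Projector

variable {G : Type*} [Group G] [TopologicalSpace G] [IsTopologicalGroup G] [MeasurableSpace G] [BorelSpace G]

/-- **The `(C, χ)`-projector** `e_{C,χ} ψ (x) = ∫_C conj χ(κ) ψ(x κ) dν(κ)`: the average of the right translates of
`ψ` by the compact subgroup `C` against the conjugate of the character `χ`, for a measure `ν` on `C`. -/
def kProj (C : Subgroup G) (ν : Measure C) (χ ψ : G → ℂ) (x : G) : ℂ :=
  ∫ κ : C, conj (χ κ) * ψ (x * κ) ∂ν

variable (C : Subgroup G) (ν : Measure C)

omit [TopologicalSpace G] [IsTopologicalGroup G] [BorelSpace G] in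
/-- `e_{C,χ} 0 = 0`. -/
theorem kProj_zero (χ : G → ℂ) : kProj C ν χ (fun _ => 0) = fun _ => 0 := by
  funext x; simp [kProj]

omit [TopologicalSpace G] [IsTopologicalGroup G] [BorelSpace G] in
/-- `e_{C,χ}` is homogeneous. -/
theorem kProj_const_mul (χ ψ : G → ℂ) (c : ℂ) :
    kProj C ν χ (fun y => c * ψ y) = fun x => c * kProj C ν χ ψ x := by
  funext x
  simp only [kProj]
  rw [← integral_const_mul]
  congr 1
  funext κ
  ring

omit [TopologicalSpace G] [IsTopologicalGroup G] [BorelSpace G] in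
/-- `e_{C,χ}` is additive on functions whose integrands are integrable (e.g. continuous members, `kProj_add`). -/
theorem kProj_add_of_integrable {χ ψ₁ ψ₂ : G → ℂ}
    (h₁ : ∀ x, Integrable (fun κ : C => conj (χ κ) * ψ₁ (x * κ)) ν)
    (h₂ : ∀ x, Integrable (fun κ : C => conj (χ κ) * ψ₂ (x * κ)) ν) :
    kProj C ν χ (fun y => ψ₁ y + ψ₂ y) = fun x => kProj C ν χ ψ₁ x + kProj C ν χ ψ₂ x := by
  funext x
  simp only [kProj]
  rw [← integral_add (h₁ x) (h₂ x)]
  congr 1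
  funext κ
  ring

/-- **The output of the projector is right-`(C, χ)`-equivariant**: `e_{C,χ} ψ (x κ₀) = χ(κ₀) · e_{C,χ} ψ (x)` for
`κ₀ ∈ C` (substitute `κ ↦ κ₀⁻¹ κ`; left invariance of `ν`; `conj χ(κ₀⁻¹) = χ(κ₀)`). -/
theorem kProj_apply_mul [ν.IsMulLeftInvariant] {χ : G → ℂ} (hχ : ∀ a ∈ C, ∀ b ∈ C, χ (a * b) = χ a * χ b)
    (hu : ∀ a ∈ C, ‖χ a‖ = 1) (ψ : G → ℂ) (x : G) {κ₀ : G} (hκ₀ : κ₀ ∈ C) :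
    kProj C ν χ ψ (x * κ₀) = χ κ₀ * kProj C ν χ ψ x := by
  let k : C := ⟨κ₀, hκ₀⟩
  let F : C → ℂ := fun κ => conj (χ ((k⁻¹ * κ : C) : G)) * ψ (x * κ)
  have hL : (fun κ : C => conj (χ κ) * ψ (x * κ₀ * κ)) = fun κ : C => F (k * κ) := by
    funext κ
    show conj (χ κ) * ψ (x * κ₀ * κ) = conj (χ ((k⁻¹ * (k * κ) : C) : G)) * ψ (x * ((k * κ : C) : G))
    rw [inv_mul_cancel_left, Subgroup.coe_mul, mul_assoc]
  have hR : (fun κ : C => F κ) = fun κ : C => conj (χ κ₀⁻¹) * (conj (χ κ) * ψ (x * κ)) := by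
    funext κ
    show conj (χ ((k⁻¹ * κ : C) : G)) * ψ (x * κ) = conj (χ κ₀⁻¹) * (conj (χ κ) * ψ (x * κ))
    rw [Subgroup.coe_mul, Subgroup.coe_inv]
    show conj (χ (κ₀⁻¹ * κ)) * ψ (x * κ) = conj (χ κ₀⁻¹) * (conj (χ κ) * ψ (x * κ))
    rw [hχ κ₀⁻¹ (C.inv_mem hκ₀) κ κ.2, map_mul, mul_assoc]
  calc kProj C ν χ ψ (x * κ₀) = ∫ κ : C, F (k * κ) ∂ν := by rw [kProj, hL]
    _ = ∫ κ : C, F κ ∂ν := integral_mul_left_eq_self F k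
    _ = conj (χ κ₀⁻¹) * ∫ κ : C, conj (χ κ) * ψ (x * κ) ∂ν := by rw [hR, integral_const_mul]
    _ = χ κ₀ * kProj C ν χ ψ x := by rw [conj_chi_inv C hχ hu hκ₀, kProj]

omit [TopologicalSpace G] [IsTopologicalGroup G] [BorelSpace G] in
/-- **The projector fixes the equivariant functions**: `e_{C,χ} ψ = ψ` when `ψ (x κ) = χ(κ) ψ(x)` for `κ ∈ C`
(`ν` a probability measure, `‖χ‖ = 1` on `C`). -/
theorem kProj_of_equivariant [IsProbabilityMeasure ν] {χ : G → ℂ} (hu : ∀ a ∈ C, ‖χ a‖ = 1) {ψ : G → ℂ}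
    (hψ : ∀ x, ∀ κ ∈ C, ψ (x * κ) = χ κ * ψ x) : kProj C ν χ ψ = ψ := by
  funext x
  have : (fun κ : C => conj (χ κ) * ψ (x * κ)) = fun _ => ψ x := by
    funext κ
    rw [hψ x κ κ.2, ← mul_assoc, conj_chi_mul_chi C hu κ.2, one_mul]
  rw [kProj, this, integral_const, probReal_univ, one_smul]

/-- **Idempotence**: `e_{C,χ} (e_{C,χ} ψ) = e_{C,χ} ψ`. -/
theorem kProj_kProj [ν.IsMulLeftInvariant] [IsProbabilityMeasure ν] {χ : G → ℂ}
    (hχ : ∀ a ∈ C, ∀ b ∈ C, χ (a * b) = χ a * χ b) (hu : ∀ a ∈ C, ‖χ a‖ = 1) (ψ : G → ℂ) :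
    kProj C ν χ (kProj C ν χ ψ) = kProj C ν χ ψ :=
  kProj_of_equivariant C ν hu fun x _ hκ => kProj_apply_mul C ν hχ hu ψ x hκ

/-- A continuous function on a compact space is integrable for a finite measure. -/
theorem integrable_of_continuous_compactSpace {X : Type*} [TopologicalSpace X] [CompactSpace X]
    [MeasurableSpace X] [OpensMeasurableSpace X] (m : Measure X) [IsFiniteMeasure m] {g : X → ℂ}
    (hg : Continuous g) : Integrable g m :=
  hg.integrable_of_hasCompactSupport (HasCompactSupport.of_compactSpace g)

/-- The integrand of `e_{C,χ} ψ (x)` is integrable for continuous `χ` (on `C`) and `ψ`, `C` compact, `ν` finite. -/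
theorem integrable_kProj_integrand [CompactSpace C] [IsFiniteMeasure ν] {χ : G → ℂ}
    (hχc : Continuous fun κ : C => χ κ) {ψ : G → ℂ} (hψ : Continuous ψ) (x : G) :
    Integrable (fun κ : C => conj (χ κ) * ψ (x * κ)) ν :=
  integrable_of_continuous_compactSpace ν
    (((Complex.continuous_conj).comp hχc).mul (hψ.comp (continuous_const.mul continuous_subtype_val)))

/-- `e_{C,χ}` is additive on continuous functions. -/
theorem kProj_add [CompactSpace C] [IsFiniteMeasure ν] {χ : G → ℂ} (hχc : Continuous fun κ : C => χ κ)
    {ψ₁ ψ₂ : G → ℂ} (h₁ : Continuous ψ₁) (h₂ : Continuous ψ₂) :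
    kProj C ν χ (fun y => ψ₁ y + ψ₂ y) = fun x => kProj C ν χ ψ₁ x + kProj C ν χ ψ₂ x :=
  kProj_add_of_integrable C ν (fun x => integrable_kProj_integrand C ν hχc h₁ x)
    (fun x => integrable_kProj_integrand C ν hχc h₂ x)

/-- `e_{C,χ}` respects differences of continuous functions. -/
theorem kProj_sub [CompactSpace C] [IsFiniteMeasure ν] {χ : G → ℂ} (hχc : Continuous fun κ : C => χ κ)
    {ψ₁ ψ₂ : G → ℂ} (h₁ : Continuous ψ₁) (h₂ : Continuous ψ₂) :
    kProj C ν χ (fun y => ψ₁ y - ψ₂ y) = fun x => kProj C ν χ ψ₁ x - kProj C ν χ ψ₂ x := by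
  funext x
  simp only [kProj]
  rw [← integral_sub (integrable_kProj_integrand C ν hχc h₁ x) (integrable_kProj_integrand C ν hχc h₂ x)]
  congr 1
  funext κ
  ring

/-- **Continuity of the projector's output** for continuous `ψ` (and `χ` on `C`): a parametric integral over the
compact `C` (`G` locally compact and first countable). -/
theorem continuous_kProj [CompactSpace C] [IsFiniteMeasure ν] [LocallyCompactSpace G]
    [FirstCountableTopology G] {χ : G → ℂ} (hχc : Continuous fun κ : C => χ κ) {ψ : G → ℂ}
    (hψ : Continuous ψ) : Continuous (kProj C ν χ ψ) := by
  have h : Continuous (Function.uncurry fun (x : G) (κ : C) => conj (χ κ) * ψ (x * κ)) := by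
    apply Continuous.mul
    · exact (Complex.continuous_conj).comp (hχc.comp continuous_snd)
    · exact hψ.comp (continuous_fst.mul (continuous_subtype_val.comp continuous_snd))
  have := continuous_parametric_integral_of_continuous (μ := ν) h isCompact_univ
  simp only [Measure.restrict_univ] at this
  exact this

end Projector

section ProjectorIdentity

variable {G : Type*} [Group G] [TopologicalSpace G] [IsTopologicalGroup G] [MeasurableSpace G] [BorelSpace G]
  [SecondCountableTopology G] (C : Subgroup G) (ν : Measure C) (μ : Measure G)

/-- The product integrand of the projector identity is integrable on `μ.prod ν` (continuous, support inside
`tsupport f ×ˢ univ`, `C` compact). -/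
theorem integrable_prod_kProj [CompactSpace C] [IsFiniteMeasure ν] [IsFiniteMeasureOnCompacts μ]
    {χ : G → ℂ} (hχc : Continuous fun κ : C => χ κ) {f ψ : G → ℂ} (hf : Continuous f)
    (hfc : HasCompactSupport f) (hψ : Continuous ψ) (x : G) :
    Integrable (Function.uncurry fun (y : G) (κ : C) => f y * (conj (χ κ) * ψ (x * y * κ))) (μ.prod ν) := by
  apply Continuous.integrable_of_hasCompactSupport
  · apply Continuous.mul
    · exact hf.comp continuous_fst
    · apply Continuous.mul
      · exact (Complex.continuous_conj).comp (hχc.comp continuous_snd)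
      · exact hψ.comp ((continuous_const.mul continuous_fst).mul (continuous_subtype_val.comp continuous_snd))
  · apply HasCompactSupport.intro (hfc.isCompact.prod isCompact_univ)
    intro p hp
    have : p.1 ∉ tsupport f := fun h => hp ⟨h, mem_univ _⟩
    show f p.1 * (conj (χ p.2) * ψ (x * p.1 * p.2)) = 0
    rw [image_eq_zero_of_notMem_tsupport this, zero_mul]

/-- **THE PROJECTOR IDENTITY** `R(f)(e_{C,χ} ψ) = R(f) ψ`: for a test function `f` that is right-`(C, χ̄)`-equivariant
(`f (y κ) = conj χ(κ) · f y` for `κ ∈ C`) and a continuous `ψ`,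
`∫ f(y) (e_{C,χ} ψ)(x y) dμ(y) = ∫ f(y) ψ(x y) dμ(y)`.  Proof: Fubini on `μ.prod ν`; for each `κ` the substitution
`y ↦ y κ⁻¹` (right invariance of `μ`) turns `f(y) conj χ(κ) ψ(x y κ)` into `f(y κ⁻¹) conj χ(κ) ψ(x y)
= χ(κ) conj χ(κ) f(y) ψ(x y) = f(y) ψ(x y)`; then `ν` is a probability measure. -/
theorem integral_mul_kProj_eq [CompactSpace C] [IsProbabilityMeasure ν] [SFinite μ] [μ.IsMulRightInvariant]
    [IsFiniteMeasureOnCompacts μ] {χ : G → ℂ} (hχc : Continuous fun κ : C => χ κ)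
    (hχ : ∀ a ∈ C, ∀ b ∈ C, χ (a * b) = χ a * χ b) (hu : ∀ a ∈ C, ‖χ a‖ = 1) {f ψ : G → ℂ}
    (hf : Continuous f) (hfc : HasCompactSupport f) (hψ : Continuous ψ)
    (hfe : ∀ y, ∀ κ ∈ C, f (y * κ) = conj (χ κ) * f y) (x : G) :
    ∫ y, f y * kProj C ν χ ψ (x * y) ∂μ = ∫ y, f y * ψ (x * y) ∂μ := by
  have hint := integrable_prod_kProj C ν μ hχc hf hfc hψ x
  -- the inner integral over `G`, for a fixed `κ`, is independent of `κ`
  have hinner : ∀ κ : C, ∫ y, f y * (conj (χ κ) * ψ (x * y * κ)) ∂μ = ∫ y, f y * ψ (x * y) ∂μ := by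
    intro κ
    have hsub : ∫ y, f (y * κ * (κ : G)⁻¹) * (conj (χ κ) * ψ (x * (y * κ))) ∂μ
        = ∫ y, f (y * (κ : G)⁻¹) * (conj (χ κ) * ψ (x * y)) ∂μ :=
      integral_mul_right_eq_self (fun y => f (y * (κ : G)⁻¹) * (conj (χ κ) * ψ (x * y))) (κ : G)
    have e1 : (fun y => f y * (conj (χ κ) * ψ (x * y * κ)))
        = fun y => f (y * κ * (κ : G)⁻¹) * (conj (χ κ) * ψ (x * (y * κ))) := by
      funext y
      rw [mul_inv_cancel_right, mul_assoc]
    have e2 : (fun y => f (y * (κ : G)⁻¹) * (conj (χ κ) * ψ (x * y))) = fun y => f y * ψ (x * y) := by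
      funext y
      rw [hfe y (κ : G)⁻¹ (C.inv_mem κ.2), conj_chi_inv C hχ hu κ.2]
      calc χ κ * f y * (conj (χ κ) * ψ (x * y)) = (conj (χ κ) * χ κ) * (f y * ψ (x * y)) := by ring
        _ = f y * ψ (x * y) := by rw [conj_chi_mul_chi C hu κ.2, one_mul]
    rw [e1, hsub, e2]
  calc ∫ y, f y * kProj C ν χ ψ (x * y) ∂μ
      = ∫ y, ∫ κ : C, f y * (conj (χ κ) * ψ (x * y * κ)) ∂ν ∂μ := by
        congr 1
        funext y
        rw [kProj, integral_const_mul]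
    _ = ∫ κ : C, ∫ y, f y * (conj (χ κ) * ψ (x * y * κ)) ∂μ ∂ν := integral_integral_swap hint
    _ = ∫ κ : C, ∫ y, f y * ψ (x * y) ∂μ ∂ν := by
        congr 1
        funext κ
        exact hinner κ
    _ = ∫ y, f y * ψ (x * y) ∂μ := by rw [integral_const, probReal_univ, one_smul]

end ProjectorIdentity

end Summit.Ventures.HodgeRepro.Tier4.Common

end
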